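import Summits.CriticalPhenomena.PercolationContinuityZ3.Theorems.SahiBoxTP2HilbertCoupling
import Summits.CriticalPhenomena.PercolationContinuityZ3.Theorems.SahiBoxTP2HilbertImage

/-!
# Conditionally increasing sequences and monotone Markov chains on `[0,1]`: Sahi positivity of the path law

Support file of the Sahi cell (`prim-sahi`, typer seat, generation 12; `--supports stmt-CriticalPhenomena-4575`).

A second infinite-dimensional class, NOT box-TP₂ in general: laws on the Hilbert cube `ℕ → [0,1]` specified by their
successive conditional kernels `κ d : (Fin d → [0,1]) → [0,1]` (law of coordinate `d` given the first `d` coordinates).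
The standard construction of `SahiBoxTP2HilbertCoupling.lean` (`stepMap`, here with everywhere-monotone steps
`monotone_stepMap`) realises such a law as `cisLaw κ := G_* λ^ℕ` (`cisSeq`, `cisInf`); its conditional structure is
`law(x_0,…,x_d) ∘ initLast⁻¹ = law(x_0,…,x_{d−1}) ⊗ κ_d` (`cisLaw_map_finRestrict_succ_map_initLast`), and it is the
UNIQUE probability measure with this structure (`eq_cisLaw_of_forall_map_finRestrict_succ`, projective uniqueness), so
`cisLaw κ` is the law of the process and not an artefact of the construction.

* If every `κ d` is stochastically increasing in the past (a CONDITIONALLY INCREASING SEQUENCE), `G` is monotone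
  everywhere (`monotone_cisInf`), hence **given `LiebSahiContinuum d n` for all `d` (⟺ `SahiConjecture n`) the law is
  Sahi-positive of order `n`** for all measurable nonnegative monotone (`msahiE_cisLaw_nonneg`) or antitone
  (`…_antitone`) families; UNCONDITIONALLY `n ≤ 2`: CIS laws are positively associated
  (`integral_mul_integral_le_cisLaw`; Barlow–Proschan's "CIS ⇒ associated", here with singular kernels and all bounded
  measurable monotone functionals of the whole sequence).
* **Stochastically monotone Markov chains** (`markovKernels μ₀ P`: initial law `μ₀`, transition kernel `P` on `[0,1]`
  with `s ≤ t ⇒ P(s,·) ≤ₛₜ P(t,·)`; path law `markovLaw μ₀ P` with the Markov property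
  `markovLaw_map_finRestrict_succ_map_initLast`): **the path law is Sahi-positive of every order `n` for which `C_n`
  holds** (`msahiE_markovLaw_nonneg(_of_sahiConjecture/_antitone)`), and associated unconditionally
  (`integral_mul_integral_le_markovLaw`, Daley 1968).  Chains on `ℝ` or on countable ordered state spaces reduce to
  `[0,1]` by a monotone measurable embedding.

HONEST FRAMING (cell rule): `SahiConjecture n` (`n ≥ 3`) is OPEN and enters only as a hypothesis; the unconditional
content is the order-`2` layer [folklore: Daley 1968; Barlow–Proschan 1975; Karlin–Rinott 1980].  No sorries, no new
axioms.
-/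

noncomputable section

namespace Summit.CriticalPhenomena.PercolationContinuityZ3.Theorems.SahiBoxTP2

open MeasureTheory ProbabilityTheory Set Filter Topology Function Literature.Combinatorics.Sahi2008
open scoped ENNReal unitInterval

/-! ### Everywhere-monotone steps -/

section Step

variable {d : ℕ} {G : (Fin d → I) → (Fin d → I)} (κ : Kernel (Fin d → I) I) [IsMarkovKernel κ]

/-- **The step map is monotone** when `G` is monotone and `κ` is stochastically increasing (everywhere). [folklore] -/
theorem monotone_stepMap (hG : Monotone G) (hκ : ∀ ⦃a b : Fin d → I⦄, a ≤ b → ∀ y : I, κ b (Iic y) ≤ κ a (Iic y)) :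
    Monotone (stepMap G κ) := by
  intro x y hxy
  have hexy : splitLast d x ≤ splitLast d y := splitLast_mono hxy
  have hG2 : G (splitLast d x).2 ≤ G (splitLast d y).2 := hG hexy.2
  refine splitLast_symm_mono (d := d) (show (_, G (splitLast d x).2) ≤ (_, G (splitLast d y).2) from ⟨?_, hG2⟩)
  rw [KernelQuantile.kq_apply, KernelQuantile.kq_apply]
  exact (UnitIntervalQuantile.quantile_mono (κ (G (splitLast d x).2)) hexy.1).trans
    (UnitIntervalQuantile.quantile_mono_measure _ _ (hκ hG2) _)

end Step

/-! ### The standard construction of a conditionally specified sequence -/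

section CIS

variable (κ : (d : ℕ) → Kernel (Fin d → I) I) [hκM : ∀ d, IsMarkovKernel (κ d)]

/-- **The standard construction** of the sequence with conditional kernels `κ d` (law of coordinate `d` given the first
`d` coordinates): `G_0 = id`, `G_{d+1} = stepMap G_d (κ d)` on `Q_{d+1}`. -/
def cisSeq : (d : ℕ) → (Fin d → I) → (Fin d → I)
  | 0 => id
  | d + 1 => stepMap (cisSeq d) (κ d)

/-- `G_{d+1} = stepMap G_d (κ d)`. [folklore] -/
theorem cisSeq_succ (d : ℕ) : cisSeq κ (d + 1) = stepMap (cisSeq κ d) (κ d) := rfl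

/-- Compatibility of the finite stages. [folklore] -/
theorem initLast_cisSeq_succ_fst (d : ℕ) (x : Fin (d + 1) → I) :
    (initLast (cisSeq κ (d + 1) x)).1 = cisSeq κ d (initLast x).1 :=
  initLast_stepMap_fst _ _ x

/-- Each stage is measurable. [folklore] -/
theorem measurable_cisSeq : ∀ d, Measurable (cisSeq κ d)
  | 0 => measurable_id
  | d + 1 => measurable_stepMap (κ d) (measurable_cisSeq d)

/-- **The standard construction on the Hilbert cube**: coordinate `k` of `G u` is the last coordinate of
`G_{k+1}(u_0,…,u_k)`. -/
def cisInf (u : ℕ → I) : ℕ → I := fun k => cisSeq κ (k + 1) (finRestrict (k + 1) u) (Fin.last k)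

/-- Compatibility with every finite stage. [folklore] -/
theorem finRestrict_cisInf : ∀ (d : ℕ) (u : ℕ → I), finRestrict d (cisInf κ u) = cisSeq κ d (finRestrict d u)
  | 0 => fun u => Subsingleton.elim _ _
  | d + 1 => fun u => by
    funext i
    refine Fin.lastCases ?_ (fun j => ?_) i
    · rfl
    · have h1 : finRestrict (d + 1) (cisInf κ u) (Fin.castSucc j) = finRestrict d (cisInf κ u) j := rfl
      have h2 : cisSeq κ (d + 1) (finRestrict (d + 1) u) (Fin.castSucc j) =
          (initLast (cisSeq κ (d + 1) (finRestrict (d + 1) u))).1 j := by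
        change _ = Fin.removeNth (Fin.last d) (cisSeq κ (d + 1) (finRestrict (d + 1) u)) j
        rw [Fin.removeNth_last]; rfl
      rw [h1, h2, initLast_cisSeq_succ_fst, initLast_finRestrict_succ, finRestrict_cisInf d u]

/-- The construction is measurable. [folklore] -/
theorem measurable_cisInf : Measurable (cisInf κ) :=
  measurable_pi_lambda _ fun k =>
    (measurable_pi_apply (Fin.last k)).comp ((measurable_cisSeq κ (k + 1)).comp (measurable_finRestrict _))

/-- **The law of the conditionally specified sequence**: the image of `λ^ℕ` under the standard construction. -/
def cisLaw : Measure (ℕ → I) := lebesgueHilbert.map (cisInf κ)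

/-- The law is a probability measure. [folklore] -/
instance instIsProbabilityMeasureCisLaw : IsProbabilityMeasure (cisLaw κ) :=
  Measure.isProbabilityMeasure_map (measurable_cisInf κ).aemeasurable

/-- The finite-dimensional marginals of the law are the laws of the finite stages. [folklore] -/
theorem cisLaw_map_finRestrict (d : ℕ) :
    (cisLaw κ).map (finRestrict d) = (volume : Measure (Fin d → I)).map (cisSeq κ d) := by
  rw [cisLaw, Measure.map_map (measurable_finRestrict d) (measurable_cisInf κ),
    show finRestrict d ∘ cisInf κ = cisSeq κ d ∘ finRestrict d from funext (finRestrict_cisInf κ d),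
    ← Measure.map_map (measurable_cisSeq κ d) (measurable_finRestrict d), lebesgueHilbert_map_finRestrict]

/-- **The conditional structure of the law**: the `(d+1)`-marginal is the `d`-marginal composed with the kernel
`κ d` — coordinate `d` given the first `d` coordinates has conditional law `κ d`. [this work] -/
theorem cisLaw_map_finRestrict_succ (d : ℕ) :
    (cisLaw κ).map (finRestrict (d + 1)) =
      (((cisLaw κ).map (finRestrict d)) ⊗ₘ κ d).map (fun p : (Fin d → I) × I => (splitLast d).symm (p.2, p.1)) := by
  rw [cisLaw_map_finRestrict, cisLaw_map_finRestrict, cisSeq_succ, volume_map_stepMap (κ d) (measurable_cisSeq κ d)]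

/-- Equivalently, through `initLast`: `law(x_0,…,x_d) ∘ initLast⁻¹ = law(x_0,…,x_{d-1}) ⊗ κ_d`. [this work] -/
theorem cisLaw_map_finRestrict_succ_map_initLast (d : ℕ) :
    ((cisLaw κ).map (finRestrict (d + 1))).map initLast = ((cisLaw κ).map (finRestrict d)) ⊗ₘ κ d := by
  have hsw : Measurable fun p : (Fin d → I) × I => (splitLast d).symm (p.2, p.1) :=
    (splitLast d).symm.measurable.comp measurable_swap
  rw [cisLaw_map_finRestrict_succ, Measure.map_map measurable_initLast hsw]
  convert Measure.map_id using 2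
  funext p
  change ((splitLast d ((splitLast d).symm (p.2, p.1))).2, (splitLast d ((splitLast d).symm (p.2, p.1))).1) = p
  rw [MeasurableEquiv.apply_symm_apply]

/-- **Uniqueness**: a probability measure on the Hilbert cube whose successive conditional kernels are the `κ d` (and
whose `0`-dimensional marginal is trivial) is `cisLaw κ`. [this work] -/
theorem eq_cisLaw_of_forall_map_finRestrict_succ (ν : Measure (ℕ → I)) [IsProbabilityMeasure ν]
    (hν : ∀ d, (ν.map (finRestrict (d + 1))).map initLast = (ν.map (finRestrict d)) ⊗ₘ κ d) : ν = cisLaw κ := by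
  refine ext_of_map_finRestrict fun d => ?_
  induction d with
  | zero =>
    haveI : IsProbabilityMeasure (ν.map (finRestrict 0)) :=
      Measure.isProbabilityMeasure_map (measurable_finRestrict 0).aemeasurable
    ext s hs
    by_cases hne : s.Nonempty
    · rw [Subsingleton.eq_univ_of_nonempty hne, measure_univ, measure_univ]
    · rw [not_nonempty_iff_eq_empty.1 hne, measure_empty, measure_empty]
  | succ d ih =>
    have hsw : Measurable fun p : (Fin d → I) × I => (splitLast d).symm (p.2, p.1) :=
      (splitLast d).symm.measurable.comp measurable_swap
    have key : ∀ ρ : Measure (Fin (d + 1) → I), ρ = (ρ.map initLast).map (fun p => (splitLast d).symm (p.2, p.1)) := by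
      intro ρ
      rw [Measure.map_map hsw measurable_initLast]
      convert (Measure.map_id (μ := ρ)).symm using 2
      funext x
      exact (splitLast d).symm_apply_apply x
    rw [key (ν.map (finRestrict (d + 1))), hν d, ih, cisLaw_map_finRestrict_succ]

variable {κ}

/-- **The standard construction is monotone** when every conditional kernel is stochastically increasing in the
past (a conditionally increasing sequence, CIS). [folklore] -/
theorem monotone_cisSeq (hκ : ∀ d ⦃a b : Fin d → I⦄, a ≤ b → ∀ y : I, κ d b (Iic y) ≤ κ d a (Iic y)) :
    ∀ d, Monotone (cisSeq κ d)
  | 0 => monotone_id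
  | d + 1 => monotone_stepMap (κ d) (monotone_cisSeq hκ d) (hκ d)

/-- … and so is the construction on the Hilbert cube. [folklore] -/
theorem monotone_cisInf (hκ : ∀ d ⦃a b : Fin d → I⦄, a ≤ b → ∀ y : I, κ d b (Iic y) ≤ κ d a (Iic y)) :
    Monotone (cisInf κ) := by
  intro u v huv k
  change finRestrict (k + 1) (cisInf κ u) (Fin.last k) ≤ finRestrict (k + 1) (cisInf κ v) (Fin.last k)
  rw [finRestrict_cisInf, finRestrict_cisInf]
  exact monotone_cisSeq hκ (k + 1) (finRestrict_mono (k + 1) huv) (Fin.last k)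

variable {n : ℕ}

/-- **CIS LAWS ARE SAHI-POSITIVE (given the continuous case).**  If every conditional kernel `κ d` is stochastically
increasing in the past and `LiebSahiContinuum d n` holds for every `d` (⟺ `SahiConjecture n`), then the law of the
sequence satisfies `E_n(f_0,…,f_{n−1}) ≥ 0` for all measurable nonnegative monotone `f_i` on the Hilbert cube (the law
is an everywhere-monotone Borel image of `λ^ℕ`).  Order `2` is "conditionally increasing in sequence ⇒ associated"
(Barlow–Proschan 1975). [this work] -/
theorem msahiE_cisLaw_nonneg (hκ : ∀ d ⦃a b : Fin d → I⦄, a ≤ b → ∀ y : I, κ d b (Iic y) ≤ κ d a (Iic y))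
    (hL : ∀ d, LiebSahiContinuum d n) (f : Fin n → (ℕ → I) → ℝ) (hfm : ∀ i, Measurable (f i))
    (hf0 : ∀ i u, 0 ≤ f i u) (hmono : ∀ i, Monotone (f i)) : 0 ≤ msahiE (cisLaw κ) n f := by
  have hfC : ∀ i u, f i u ≤ ∑ j, f j (fun _ => 1) := fun i u =>
    (hmono i fun k => unitInterval.le_one (u k)).trans
      (Finset.single_le_sum (fun j _ => hf0 j _) (Finset.mem_univ i))
  exact msahiE_map_lebesgueHilbert_nonneg_of_monotoneOn hL (measurable_cisInf κ) (S := univ)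
    (ae_of_all _ fun u => mem_univ u) (fun u _ v _ huv => monotone_cisInf hκ huv) f hfm hf0 hfC hmono

/-- The same from `C_n`. [this work; cite: Sahi2008, Conj. 5 (p. 212); LiebSahi2021, Conj. 1.1] -/
theorem msahiE_cisLaw_nonneg_of_sahiConjecture
    (hκ : ∀ d ⦃a b : Fin d → I⦄, a ≤ b → ∀ y : I, κ d b (Iic y) ≤ κ d a (Iic y)) (hC : SahiConjecture n)
    (f : Fin n → (ℕ → I) → ℝ) (hfm : ∀ i, Measurable (f i)) (hf0 : ∀ i u, 0 ≤ f i u) (hmono : ∀ i, Monotone (f i)) :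
    0 ≤ msahiE (cisLaw κ) n f :=
  msahiE_cisLaw_nonneg hκ ((sahiConjecture_iff_forall_liebSahiContinuum n).1 hC) f hfm hf0 hmono

/-- Decreasing families under a CIS law (pull back along the monotone construction and use the antitone Hilbert-cube
theorem for `λ^ℕ`). [this work] -/
theorem msahiE_cisLaw_nonneg_antitone
    (hκ : ∀ d ⦃a b : Fin d → I⦄, a ≤ b → ∀ y : I, κ d b (Iic y) ≤ κ d a (Iic y)) (hL : ∀ d, LiebSahiContinuum d n)
    (f : Fin n → (ℕ → I) → ℝ) (hfm : ∀ i, Measurable (f i)) (hf0 : ∀ i u, 0 ≤ f i u) (hanti : ∀ i, Antitone (f i)) :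
    0 ≤ msahiE (cisLaw κ) n f := by
  have hmp : MeasurePreserving (cisInf κ) lebesgueHilbert (cisLaw κ) := ⟨measurable_cisInf κ, rfl⟩
  rw [← msahiE_comp_measurePreserving_of_measurable hmp n f hfm]
  exact SahiInfiniteVolume.msahiE_infinitePi_unitInterval_nonneg_of_liebSahiContinuum_antitone (fun _ => volume) hL
    (fun i => f i ∘ cisInf κ) (fun i => (hfm i).comp (measurable_cisInf κ)) (fun i u => hf0 i _)
    fun i u v huv => hanti i (monotone_cisInf hκ huv)

/-- **Unconditionally, `n ≤ 2`: CIS laws on the Hilbert cube are positively associated** for all measurable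
nonnegative monotone functions. [folklore: Barlow–Proschan 1975 (CIS ⇒ associated), here with singular kernels] -/
theorem msahiE_cisLaw_nonneg_of_le_two
    (hκ : ∀ d ⦃a b : Fin d → I⦄, a ≤ b → ∀ y : I, κ d b (Iic y) ≤ κ d a (Iic y)) (hn : n ≤ 2)
    (f : Fin n → (ℕ → I) → ℝ) (hfm : ∀ i, Measurable (f i)) (hf0 : ∀ i u, 0 ≤ f i u) (hmono : ∀ i, Monotone (f i)) :
    0 ≤ msahiE (cisLaw κ) n f :=
  msahiE_cisLaw_nonneg hκ (fun d => liebSahiContinuum_of_order_le_two d hn) f hfm hf0 hmono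

/-- The FKG inequality for CIS laws, covariance form. [folklore] -/
theorem integral_mul_integral_le_cisLaw
    (hκ : ∀ d ⦃a b : Fin d → I⦄, a ≤ b → ∀ y : I, κ d b (Iic y) ≤ κ d a (Iic y)) {f g : (ℕ → I) → ℝ}
    (hfm : Measurable f) (hgm : Measurable g) (hf0 : ∀ u, 0 ≤ f u) (hg0 : ∀ u, 0 ≤ g u) (hf : Monotone f)
    (hg : Monotone g) : (∫ u, f u ∂cisLaw κ) * (∫ u, g u ∂cisLaw κ) ≤ ∫ u, f u * g u ∂cisLaw κ := by
  have h := msahiE_cisLaw_nonneg_of_le_two hκ le_rfl ![f, g] (fun i => by fin_cases i <;> assumption)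
    (fun i => by fin_cases i <;> assumption) (fun i => by fin_cases i <;> assumption)
  rw [msahiE_two] at h
  linarith

end CIS

/-! ### Stochastically monotone Markov chains on `[0,1]` -/

section Markov

variable (μ₀ : Measure I) [IsProbabilityMeasure μ₀] (P : Kernel I I) [IsMarkovKernel P]

/-- The conditional kernels of the Markov chain with initial law `μ₀` and transition kernel `P`: coordinate `0` has
law `μ₀`, coordinate `d+1` given the past has law `P(x_d, ·)`. -/
def markovKernels : (d : ℕ) → Kernel (Fin d → I) I
  | 0 => Kernel.const _ μ₀
  | d + 1 => P.comap (fun x : Fin (d + 1) → I => x (Fin.last d)) (measurable_pi_apply _)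

/-- The Markov kernels are Markov kernels. -/
instance instIsMarkovKernelMarkovKernels : ∀ d, IsMarkovKernel (markovKernels μ₀ P d)
  | 0 => by rw [markovKernels]; infer_instance
  | d + 1 => by rw [markovKernels]; infer_instance

/-- **The path law of the Markov chain** `(X_0, X_1, …)` with initial law `μ₀` and transition kernel `P`, realised
on the Hilbert cube by the standard construction. -/
def markovLaw : Measure (ℕ → I) := cisLaw (markovKernels μ₀ P)

/-- The path law is a probability measure. [folklore] -/
instance instIsProbabilityMeasureMarkovLaw : IsProbabilityMeasure (markovLaw μ₀ P) := by
  rw [markovLaw]; infer_instance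

/-- **The Markov property of the path law**: `law(X_0,…,X_{d+1}) ∘ initLast⁻¹ = law(X_0,…,X_d) ⊗ P(X_d, ·)`.
[this work] -/
theorem markovLaw_map_finRestrict_succ_map_initLast (d : ℕ) :
    ((markovLaw μ₀ P).map (finRestrict (d + 1))).map initLast =
      ((markovLaw μ₀ P).map (finRestrict d)) ⊗ₘ markovKernels μ₀ P d :=
  cisLaw_map_finRestrict_succ_map_initLast _ d

variable {μ₀ P}

omit [IsProbabilityMeasure μ₀] [IsMarkovKernel P] in
/-- A stochastically monotone transition kernel gives stochastically increasing conditional kernels. [folklore] -/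
theorem markovKernels_mono (hP : ∀ ⦃s t : I⦄, s ≤ t → ∀ y : I, P t (Iic y) ≤ P s (Iic y)) :
    ∀ d ⦃a b : Fin d → I⦄, a ≤ b → ∀ y : I, markovKernels μ₀ P d b (Iic y) ≤ markovKernels μ₀ P d a (Iic y)
  | 0 => fun a b _ y => by simp only [markovKernels, Kernel.const_apply, le_refl]
  | d + 1 => fun a b hab y => by
    simp only [markovKernels, Kernel.comap_apply]
    exact hP (hab (Fin.last d)) y

variable {n : ℕ}

/-- **STOCHASTICALLY MONOTONE MARKOV CHAINS ARE SAHI-POSITIVE (given `C_n`).**  If the transition kernel `P` on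
`[0,1]` is stochastically monotone (`s ≤ t ⇒ P(s,·) ≤ₛₜ P(t,·)`) and `LiebSahiContinuum d n` holds for every `d`, then
the path law satisfies `E_n(f_0,…,f_{n−1}) ≥ 0` for all measurable nonnegative monotone path functionals `f_i` (any
initial law). [this work] -/
theorem msahiE_markovLaw_nonneg (hP : ∀ ⦃s t : I⦄, s ≤ t → ∀ y : I, P t (Iic y) ≤ P s (Iic y))
    (hL : ∀ d, LiebSahiContinuum d n) (f : Fin n → (ℕ → I) → ℝ) (hfm : ∀ i, Measurable (f i))
    (hf0 : ∀ i u, 0 ≤ f i u) (hmono : ∀ i, Monotone (f i)) : 0 ≤ msahiE (markovLaw μ₀ P) n f :=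
  msahiE_cisLaw_nonneg (markovKernels_mono hP) hL f hfm hf0 hmono

/-- The same from `C_n`. [this work; cite: Sahi2008, Conj. 5 (p. 212); LiebSahi2021, Conj. 1.1] -/
theorem msahiE_markovLaw_nonneg_of_sahiConjecture (hP : ∀ ⦃s t : I⦄, s ≤ t → ∀ y : I, P t (Iic y) ≤ P s (Iic y))
    (hC : SahiConjecture n) (f : Fin n → (ℕ → I) → ℝ) (hfm : ∀ i, Measurable (f i)) (hf0 : ∀ i u, 0 ≤ f i u)
    (hmono : ∀ i, Monotone (f i)) : 0 ≤ msahiE (markovLaw μ₀ P) n f :=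
  msahiE_cisLaw_nonneg_of_sahiConjecture (markovKernels_mono hP) hC f hfm hf0 hmono

/-- Decreasing path functionals. [this work] -/
theorem msahiE_markovLaw_nonneg_antitone (hP : ∀ ⦃s t : I⦄, s ≤ t → ∀ y : I, P t (Iic y) ≤ P s (Iic y))
    (hL : ∀ d, LiebSahiContinuum d n) (f : Fin n → (ℕ → I) → ℝ) (hfm : ∀ i, Measurable (f i))
    (hf0 : ∀ i u, 0 ≤ f i u) (hanti : ∀ i, Antitone (f i)) : 0 ≤ msahiE (markovLaw μ₀ P) n f :=
  msahiE_cisLaw_nonneg_antitone (markovKernels_mono hP) hL f hfm hf0 hanti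

/-- **Unconditionally: stochastically monotone Markov chains are associated** (Daley 1968), here for all measurable
nonnegative monotone path functionals: `∫ f ∫ g ≤ ∫ f g` under the path law. [folklore] -/
theorem integral_mul_integral_le_markovLaw (hP : ∀ ⦃s t : I⦄, s ≤ t → ∀ y : I, P t (Iic y) ≤ P s (Iic y))
    {f g : (ℕ → I) → ℝ} (hfm : Measurable f) (hgm : Measurable g) (hf0 : ∀ u, 0 ≤ f u) (hg0 : ∀ u, 0 ≤ g u)
    (hf : Monotone f) (hg : Monotone g) :
    (∫ u, f u ∂markovLaw μ₀ P) * (∫ u, g u ∂markovLaw μ₀ P) ≤ ∫ u, f u * g u ∂markovLaw μ₀ P :=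
  integral_mul_integral_le_cisLaw (markovKernels_mono hP) hfm hgm hf0 hg0 hf hg

end Markov

end Summit.CriticalPhenomena.PercolationContinuityZ3.Theorems.SahiBoxTP2
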